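import Summits.CriticalPhenomena.PercolationContinuityZ3.Theorems.PercNearOneGluingNoHeavyQuantTwinMove
import Summits.CriticalPhenomena.PercolationContinuityZ3.Theorems.PercNearOneGluingNoHeavyQuantFlowBlobUnits
import HarnessLib

/-!
# QUANT lane R8, T-DEC, leg (III): the blob gate move / window form CW when the partner law's layer-`j` datum is PURE GIANT —
# **`decAtT_gateMoveBlob_of_critE`**: criterion E for `ν` at ONE layer `j` (target `S`) already makes the moved slice
# `slice ν a g + gz(δ₀ − δ_a)` DEC at `(y, S + ag − zag, j)`, for every blob size `a`, every `z ≤ ν 0`, with NO hypothesis on `Λ`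

builds on p205010 (kernel theorem, internal audit signed; external expert review pending)

Support file (`--supports stmt-CriticalPhenomena-4575`), QUANT lane seat prim-quant-arm-1 (gen 40), rung R8 of
`run/shared/lean/prim/quant/LADDER.md`.  Theorems only (no definitions), standard axioms, no sorries.  Part 2 of 2 (part 1: `…QuantFlowBlobUnits`).  Context: every ONE-LAYER form of
the blob step with a DEC DATUM is refuted (`MixedShiftDEC`, `TwinMoveDEC` — arm-3 g62 `not_twinMoveDEC` —, the move lemma (M) without
`hsupp` — lead g30 `gateMoveBlob_general_witness`); the statement of record is the WINDOW form CW (`run/shared/lean/prim/quant/FOR-PROVERS-CW.md`).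
This file proves the branch of CW in which the partner's datum at the layer `j` is criterion E (all `S`-lows ride the giants): then ONE
layer suffices, at every `j`, dominant or not.  (Lead g30's corner runs: CW is SHARP exactly on this pure-giant sub-family.)  Exact check of the
statement before typing: 6 533 instances with `y` bisected to the E-edge of layer `j` (4 262 of them non-dominant, `2j ≥ t`), 0 failures
(`work/explore/cw_pureE*.py` of the seat; engines census-2 `dec.py`/`lp.py` + lead g29 `declp.py`).

THE ROUTING (memo `run/shared/lean/prim/quant/prim-quant-arm-1-g40/CW-PRIMAL-G40.md` §3).  Write `P = slice ν a g + gz(δ₀ − δ_a)` as the sum of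
three measures: `A = (1−g)·ν` WITHOUT its new lows (the atoms `l ≤ j` with `S ≤ 2l < t`, lows at the raised target only); `C = Σ_{new l} ν l·{l, l+a; g}`
(each new low with its own twin — a blob unit); `B = g·(zδ₀ + shift_a(ν − zδ₀ − ν|new))` (the shifted copy, the `z`-part of the zero left at `0`).
`A` and `B` satisfy criterion E at `(t, j)` from criterion E of `ν` at `(S, j)` ALONE: `A`'s `t`-lows are `ν`'s `S`-lows and its giants are `ν`'s;
`B`'s `t`-lows are the zero parts and the shifted copies `k + a` of `S`-lows `k` of `ν` with `2(k+a) < t` (so `2k < S`), its giants `{k + a > j}`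
contain the shifted copies of `ν`'s giants `{k > j}`; each blob unit of `C` is a valid pair on its own (`(t − 2l)/a ≤ g(1−z) ≤ g`, and `y ≤ g`).
The cone property of the flow form (`FlowAtT.add`, typer g23) and `decAtT_of_flowAtT` finish.  No top-affordability, no regime `t ≤ 2a`, no
datum of `Λ` is used; `j < a` is included.

* tools (part 1, `…QuantFlowBlobUnits`): `flowAtT_zero`, `flowAtT_finset_sum`, `flowAtT_blobUnit`, `sum_mul_indicator_shift`.
* **`LawDec.decAtT_gateMoveBlob_of_critE`** — the theorem (binder of typer g27's `decAtT_gateMoveBlob` with `hsupp`/`hΛ`/`hta` replaced by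
  criterion E of `ν` at layer `j`).

HONEST STATUS: the branch of CW in which `ν`'s layer-`j` datum uses mids remains OPEN (there the window `[j−a, j]` is needed: census-2's `slCex`);
`GateMove`, `GatedConvEmptyFree`, `SingleGateConvClosed`, `TreeDEC`, `FarTreeRow` OPEN; RATE class log\* / honest sentence of
`run/shared/lean/prim/quant/README.md` UNCHANGED.

[this work]; flow form and its cone property: prim-quant-stmt g22–g26; (M) binder: prim-quant-stmt g27 (this lane).  Nothing here is cited as a
published result.  The gluing rows served [cite: KozmaNitzan2024, Conjecture 3 (p. 15)]; product measure [cite: Grimmett1999, §1.3 p. 10].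
-/

noncomputable section

namespace Summit.CriticalPhenomena.PercolationContinuityZ3.Theorems

namespace Quant

open Finset

/-- the two-point law `{lo, hi; g}` (as in `…QuantLawDEC`) -/
local notation3 "TP[" lo ", " hi ", " g ", " h "]" =>
  (g : ℝ) * (if (h : ℕ) = (hi : ℕ) then (1 : ℝ) else 0) + (1 - (g : ℝ)) * (if (h : ℕ) = (lo : ℕ) then (1 : ℝ) else 0)

namespace LawDec

/-! ### The theorem -/

/-- **THE BLOB GATE MOVE FROM CRITERION E OF THE PARTNER AT ONE LAYER.**  `0 < y < 1`, `0 ≤ z ≤ ν 0`, `g ≤ 1`, `y ≤ (1−z)g`, `1 ≤ a`;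
`ν ≥ 0` a probability law on `{0..M}`, a pivot `S > 0` (in CW: the mean of `ν`; the proof does not use that), layer `j` (any).  If `ν` satisfies CRITERION E at `(S, j)` —
`y/(1−y)·Σ_{l ≤ j, 2l < S} ν l ≤ Σ_{j < h ≤ M} ν h` (in particular whenever `ν` is DEC(j) at a dominant layer `2j < S`, `tail_ge_of_decAt`) —
then the moved slice `slice ν a g + g z (δ₀ − δ_a)` is `DECAtT y (S + ag − zag) j (M + a)`: the conclusion of typer g27's move lemma (M) and of the
window form CW, with no hypothesis on `Λ = slice ν a g`, no top-affordability and no regime restriction.  Proof: the three-measure routing of the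
module docstring (`flowAtT_of_giants` twice, `flowAtT_blobUnit` for the new lows, `FlowAtT.add`, `decAtT_of_flowAtT`). [this work] -/
theorem decAtT_gateMoveBlob_of_critE (y z g S : ℝ) (a j M : ℕ) (ν : ℕ → ℝ)
    (hy0 : 0 < y) (hy1 : y < 1) (hz0 : 0 ≤ z) (hg1 : g ≤ 1) (hyg : y ≤ (1 - z) * g) (ha : 1 ≤ a)
    (hν0 : ∀ h, 0 ≤ ν h) (hνM : ∀ h, M < h → ν h = 0) (hν1 : ∑ h ∈ Finset.range (M + 1), ν h = 1)
    (hS0 : 0 < S) (hzν : z ≤ ν 0)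
    (hE : y / (1 - y) * ∑ l ∈ Finset.range (j + 1), (if 2 * (l : ℝ) < S then ν l else 0)
      ≤ ∑ h ∈ Finset.Ico (j + 1) (M + 1), ν h) :
    DECAtT y (S + (a : ℝ) * g - z * (a : ℝ) * g) j (M + a)
      (fun h => slice ν a g h + g * z * ((if h = 0 then (1 : ℝ) else 0) - (if h = a then (1 : ℝ) else 0))) := by
  classical
  -- scalars
  have hz1 : z ≤ 1 := by
    have h0 := Finset.single_le_sum (fun h _ => hν0 h) (Finset.mem_range.2 (Nat.succ_pos M))
    rw [hν1] at h0; exact hzν.trans h0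
  have hg0 : 0 < g := by
    by_contra hc
    have : (1 - z) * g ≤ 0 := mul_nonpos_of_nonneg_of_nonpos (by linarith) (not_lt.1 hc)
    linarith
  have hyg' : y ≤ g := by nlinarith
  have ha0 : (0 : ℝ) < a := by exact_mod_cast (Nat.lt_of_lt_of_le Nat.zero_lt_one ha)
  have h1y : 0 < 1 - y := by linarith
  have huy : 0 ≤ y / (1 - y) := div_nonneg hy0.le h1y.le
  set t : ℝ := S + (a : ℝ) * g - z * (a : ℝ) * g with ht
  have hSt : S ≤ t := by rw [ht]; nlinarith [mul_nonneg ha0.le hg0.le]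
  have hta : t ≤ S + (a : ℝ) * g := by rw [ht]; nlinarith [mul_nonneg ha0.le hg0.le]
  have hta' : t - 2 * (a : ℝ) < S := by nlinarith
  set Esum : ℝ := ∑ l ∈ Finset.range (j + 1), (if 2 * (l : ℝ) < S then ν l else 0) with hEsum
  set Γ : ℝ := ∑ h ∈ Finset.Ico (j + 1) (M + 1), ν h with hΓ
  have hΓ0 : 0 ≤ Γ := Finset.sum_nonneg fun h _ => hν0 h
  -- the new lows of the unshifted copy
  set NW : Finset ℕ := (Finset.range (j + 1)).filter (fun l => 1 ≤ l ∧ S ≤ 2 * (l : ℝ) ∧ 2 * (l : ℝ) < t) with hNW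
  have memNW : ∀ l, l ∈ NW ↔ l ≤ j ∧ 1 ≤ l ∧ S ≤ 2 * (l : ℝ) ∧ 2 * (l : ℝ) < t := by
    intro l; rw [hNW, Finset.mem_filter, Finset.mem_range, Nat.lt_succ_iff]
  have NW_le_M : ∀ l, l ∈ NW → 0 < ν l → l ≤ M := by
    intro l _ hpos; by_contra hc; exact absurd (hνM l (not_le.1 hc)) hpos.ne'
  -- the three measures
  set A : ℕ → ℝ := fun h => (1 - g) * (if h ∈ NW then 0 else ν h) with hA
  set C : ℕ → ℝ := fun h => ∑ l ∈ Finset.range (j + 1), (if l ∈ NW then ν l else 0) * TP[l, l + a, g, h] with hC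
  set B : ℕ → ℝ := fun h => g * (z * (if h = 0 then (1 : ℝ) else 0)
      + (if a ≤ h then ((if h - a ∈ NW then 0 else ν (h - a)) - z * (if h = a then (1 : ℝ) else 0)) else 0)) with hB
  have hA0 : ∀ h, 0 ≤ A h := fun h => by
    simp only [hA]; exact mul_nonneg (by linarith) (by split_ifs; exacts [le_rfl, hν0 h])
  have hB0 : ∀ h, 0 ≤ B h := by
    intro h
    simp only [hB]
    refine mul_nonneg hg0.le ?_
    by_cases hah : a ≤ h
    · rw [if_pos hah]
      have h0 : h ≠ 0 := by omega
      rw [if_neg h0, mul_zero, zero_add]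
      by_cases hha : h = a
      · subst hha
        have : ¬ (h - h ∈ NW) := by rw [Nat.sub_self, memNW]; omega
        rw [if_neg this, if_pos rfl, Nat.sub_self]; linarith
      · rw [if_neg hha, mul_zero, sub_zero]; split_ifs; exacts [le_rfl, hν0 _]
    · rw [if_neg hah, add_zero]; exact mul_nonneg hz0 (by split_ifs <;> norm_num)
  -- the closed form of `C`
  have hCform : ∀ h, C h = g * (if a ≤ h then (if h - a ∈ NW then ν (h - a) else 0) else 0)
      + (1 - g) * (if h ∈ NW then ν h else 0) := by
    intro h
    have hF : ∀ l, (if l ∈ NW then ν l else 0) ≠ 0 → l < j + 1 := by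
      intro l hl
      by_cases hm : l ∈ NW
      · exact Nat.lt_succ_of_le ((memNW l).1 hm).1
      · rw [if_neg hm] at hl; exact absurd rfl hl
    have e1 := sum_mul_indicator_shift (fun l => if l ∈ NW then ν l else 0) (j + 1) a h hF
    have e2 := sum_mul_indicator_shift (fun l => if l ∈ NW then ν l else 0) (j + 1) 0 h hF
    simp only [add_zero, Nat.zero_le, if_true, Nat.sub_zero] at e2
    simp only [hC]
    have ex : ∀ l ∈ Finset.range (j + 1), (if l ∈ NW then ν l else 0) * TP[l, l + a, g, h]
        = g * ((if l ∈ NW then ν l else 0) * (if h = l + a then (1 : ℝ) else 0))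
          + (1 - g) * ((if l ∈ NW then ν l else 0) * (if h = l then (1 : ℝ) else 0)) := by
      intro l _; ring
    rw [Finset.sum_congr rfl ex, Finset.sum_add_distrib, ← Finset.mul_sum, ← Finset.mul_sum, e1, e2]
  -- the decomposition `P = A + C + B`
  have hP : (fun h => slice ν a g h + g * z * ((if h = 0 then (1 : ℝ) else 0) - (if h = a then (1 : ℝ) else 0)))
      = fun h => (A h + C h) + B h := by
    funext h
    rw [hCform h]
    simp only [hA, hB, slice]
    by_cases hah : a ≤ h
    · have h0 : h ≠ 0 := by omega
      by_cases hha : h = a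
      · have hn1 : h - a ∉ NW := by rw [hha, Nat.sub_self, memNW]; omega
        by_cases hn2 : h ∈ NW
        · simp only [if_pos hah, if_neg h0, if_pos hha, if_neg hn1, if_pos hn2]; ring
        · simp only [if_pos hah, if_neg h0, if_pos hha, if_neg hn1, if_neg hn2]; ring
      · by_cases hn1 : h - a ∈ NW
        · by_cases hn2 : h ∈ NW
          · simp only [if_pos hah, if_neg h0, if_neg hha, if_pos hn1, if_pos hn2]; ring
          · simp only [if_pos hah, if_neg h0, if_neg hha, if_pos hn1, if_neg hn2]; ring
        · by_cases hn2 : h ∈ NW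
          · simp only [if_pos hah, if_neg h0, if_neg hha, if_neg hn1, if_pos hn2]; ring
          · simp only [if_pos hah, if_neg h0, if_neg hha, if_neg hn1, if_neg hn2]; ring
    · have hha : h ≠ a := by omega
      by_cases hn2 : h ∈ NW
      · by_cases h0 : h = 0
        · simp only [if_neg hah, if_neg hha, if_pos hn2, if_pos h0]; ring
        · simp only [if_neg hah, if_neg hha, if_pos hn2, if_neg h0]; ring
      · by_cases h0 : h = 0
        · simp only [if_neg hah, if_neg hha, if_neg hn2, if_pos h0]; ring
        · simp only [if_neg hah, if_neg hha, if_neg hn2, if_neg h0]; ring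
  -- (A) the unshifted copy minus its new lows: criterion E
  have hAflow : FlowAtT y t j (M + a) A := by
    refine flowAtT_of_giants y t j (M + a) A hy0 hy1 hA0 ?_
    have elow : ∀ l ∈ Finset.range (j + 1), (if 2 * (l : ℝ) < t then A l else 0) = (1 - g) * (if 2 * (l : ℝ) < S then ν l else 0) := by
      intro l hl
      have hlj : l ≤ j := Nat.lt_succ_iff.1 (Finset.mem_range.1 hl)
      simp only [hA]
      by_cases hlS : 2 * (l : ℝ) < S
      · have hlt : 2 * (l : ℝ) < t := lt_of_lt_of_le hlS hSt
        have hn : l ∉ NW := by rw [memNW]; push Not; intro _ _ h3; linarith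
        rw [if_pos hlt, if_neg hn, if_pos hlS]
      · rw [if_neg hlS, mul_zero]
        by_cases hlt : 2 * (l : ℝ) < t
        · have hl1 : 1 ≤ l := by
            by_contra hc
            have : l = 0 := by omega
            subst this; simp at hlS; linarith
          have hn : l ∈ NW := (memNW l).2 ⟨hlj, hl1, not_lt.1 hlS, hlt⟩
          rw [if_pos hlt, if_pos hn, mul_zero]
        · rw [if_neg hlt]
    rw [Finset.sum_congr rfl elow, ← Finset.mul_sum]
    have hsub : ∑ h ∈ Finset.Ico (j + 1) (M + 1), A h ≤ ∑ h ∈ Finset.Ico (j + 1) (M + a + 1), A h :=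
      Finset.sum_le_sum_of_subset_of_nonneg (Finset.Ico_subset_Ico_right (by omega)) (fun h _ _ => hA0 h)
    have egi : ∑ h ∈ Finset.Ico (j + 1) (M + 1), A h = (1 - g) * Γ := by
      rw [hΓ, Finset.mul_sum]
      refine Finset.sum_congr rfl fun h hh => ?_
      have hn : h ∉ NW := by rw [memNW]; have := (Finset.mem_Ico.1 hh).1; omega
      simp only [hA]; rw [if_neg hn]
    calc y / (1 - y) * ((1 - g) * Esum) = (1 - g) * (y / (1 - y) * Esum) := by ring
      _ ≤ (1 - g) * Γ := mul_le_mul_of_nonneg_left hE (by linarith)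
      _ ≤ ∑ h ∈ Finset.Ico (j + 1) (M + a + 1), A h := by rw [← egi]; exact hsub
  -- (C) the new lows with their twins
  have hCflow : FlowAtT y t j (M + a) C := by
    refine flowAtT_finset_sum y t j (M + a) (Finset.range (j + 1)) (fun l h => (if l ∈ NW then ν l else 0) * TP[l, l + a, g, h]) ?_
    intro l hl
    by_cases hn : l ∈ NW
    · obtain ⟨hlj, _, hSl, hlt⟩ := (memNW l).1 hn
      simp only [if_pos hn]
      refine flowAtT_blobUnit y g t (ν l) j (M + a) l a hy0 hy1 hg0.le hg1 hyg' ha (hν0 l) hlj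
        (fun hpos => Nat.add_le_add_right (NW_le_M l hn hpos) a) hlt ?_
      linarith
    · have e : (fun h => (if l ∈ NW then ν l else 0) * TP[l, l + a, g, h]) = fun _ => 0 := by
        funext h; rw [if_neg hn, zero_mul]
      rw [e]; exact flowAtT_zero y t j (M + a)
  -- (B) the shifted copy: criterion E
  have hBflow : FlowAtT y t j (M + a) B := by
    refine flowAtT_of_giants y t j (M + a) B hy0 hy1 hB0 ?_
    -- bound of the lows of `B`
    set G : ℕ → ℝ := fun k => (if k = 0 then ν 0 - z else 0) + (if 1 ≤ k ∧ 2 * (k : ℝ) < S then ν k else 0) with hG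
    have hG0 : ∀ k, 0 ≤ G k := fun k => by
      simp only [hG]
      refine add_nonneg ?_ ?_
      · split_ifs
        · linarith
        · exact le_rfl
      · split_ifs
        · exact hν0 k
        · exact le_rfl
    have hterm : ∀ l ∈ Finset.range (j + 1), (if 2 * (l : ℝ) < t then B l else 0)
        ≤ g * (z * (if l = 0 then (1 : ℝ) else 0) + (if a ≤ l then G (l - a) else 0)) := by
      intro l _
      have hrhs0 : 0 ≤ g * (z * (if l = 0 then (1 : ℝ) else 0) + (if a ≤ l then G (l - a) else 0)) :=
        mul_nonneg hg0.le (add_nonneg (mul_nonneg hz0 (by split_ifs <;> norm_num)) (by split_ifs; exacts [hG0 _, le_rfl]))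
      by_cases hlt : 2 * (l : ℝ) < t
      · rw [if_pos hlt]
        simp only [hB]
        refine mul_le_mul_of_nonneg_left (add_le_add (le_refl _) ?_) hg0.le
        by_cases hal : a ≤ l
        · rw [if_pos hal, if_pos hal]
          simp only [hG]
          by_cases hla : l = a
          · subst hla
            have hn : l - l ∉ NW := by rw [Nat.sub_self, memNW]; omega
            rw [if_neg hn, if_pos rfl, Nat.sub_self, if_pos rfl]
            have : (0 : ℝ) ≤ (if 1 ≤ 0 ∧ 2 * ((0 : ℕ) : ℝ) < S then ν 0 else 0) := by split_ifs; exacts [hν0 0, le_rfl]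
            linarith
          · have hk1 : 1 ≤ l - a := by omega
            have hk0 : l - a ≠ 0 := by omega
            rw [if_neg hla, mul_zero, sub_zero, if_neg hk0, zero_add]
            by_cases hn : l - a ∈ NW
            · rw [if_pos hn]; split_ifs; exacts [hν0 _, le_rfl]
            · rw [if_neg hn]
              have hkS : 2 * ((l - a : ℕ) : ℝ) < S := by
                have : ((l - a : ℕ) : ℝ) = (l : ℝ) - a := by push_cast [Nat.cast_sub hal]; ring
                rw [this]; linarith
              rw [if_pos ⟨hk1, hkS⟩]
        · rw [if_neg hal, if_neg hal]
      · rw [if_neg hlt]; exact hrhs0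
    have hshift : ∑ l ∈ Finset.range (j + 1), (if a ≤ l then G (l - a) else 0) ≤ ∑ k ∈ Finset.range (j + 1), G k := by
      by_cases haj : a ≤ j
      · have e := sum_shift G (j - a) a
        rw [show j - a + a + 1 = j + 1 by omega] at e
        rw [e]
        exact Finset.sum_le_sum_of_subset_of_nonneg (Finset.range_subset_range.2 (by omega)) (fun k _ _ => hG0 k)
      · rw [Finset.sum_eq_zero (fun l hl => by
          rw [if_neg (by have := Finset.mem_range.1 hl; omega)])]
        exact Finset.sum_nonneg fun k _ => hG0 k
    have hGsum : ∑ k ∈ Finset.range (j + 1), G k = Esum - z := by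
      simp only [hG, hEsum]
      rw [Finset.sum_add_distrib, Finset.sum_ite_eq' (Finset.range (j + 1)) 0, if_pos (Finset.mem_range.2 (Nat.succ_pos j))]
      have e : ∀ k ∈ Finset.range (j + 1), (if 2 * (k : ℝ) < S then ν k else 0)
          = (if k = 0 then ν 0 else 0) + (if 1 ≤ k ∧ 2 * (k : ℝ) < S then ν k else 0) := by
        intro k _
        by_cases hk : k = 0
        · subst hk; simp [hS0]
        · rw [if_neg hk, zero_add]
          by_cases hkS : 2 * (k : ℝ) < S
          · rw [if_pos hkS, if_pos ⟨by omega, hkS⟩]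
          · rw [if_neg hkS, if_neg (fun hc => hkS hc.2)]
      rw [Finset.sum_congr rfl e, Finset.sum_add_distrib, Finset.sum_ite_eq' (Finset.range (j + 1)) 0,
        if_pos (Finset.mem_range.2 (Nat.succ_pos j))]
      ring
    have hlow : ∑ l ∈ Finset.range (j + 1), (if 2 * (l : ℝ) < t then B l else 0) ≤ g * Esum := by
      calc ∑ l ∈ Finset.range (j + 1), (if 2 * (l : ℝ) < t then B l else 0)
          ≤ ∑ l ∈ Finset.range (j + 1), g * (z * (if l = 0 then (1 : ℝ) else 0) + (if a ≤ l then G (l - a) else 0)) :=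
            Finset.sum_le_sum hterm
        _ = g * (z + ∑ l ∈ Finset.range (j + 1), (if a ≤ l then G (l - a) else 0)) := by
            rw [← Finset.mul_sum, Finset.sum_add_distrib, ← Finset.mul_sum,
              Finset.sum_ite_eq' (Finset.range (j + 1)) 0, if_pos (Finset.mem_range.2 (Nat.succ_pos j)), mul_one]
        _ ≤ g * (z + (Esum - z)) := by
            rw [← hGsum]; exact mul_le_mul_of_nonneg_left (add_le_add (le_refl _) hshift) hg0.le
        _ = g * Esum := by ring
    -- bound of the giants of `B`
    have hgiant : g * Γ ≤ ∑ h ∈ Finset.Ico (j + 1) (M + a + 1), B h := by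
      have hsub : ∑ h ∈ Finset.Ico (j + 1 + a) (M + 1 + a), B h ≤ ∑ h ∈ Finset.Ico (j + 1) (M + a + 1), B h :=
        Finset.sum_le_sum_of_subset_of_nonneg (Finset.Ico_subset_Ico (by omega) (by omega)) (fun h _ _ => hB0 h)
      have e : ∑ h ∈ Finset.Ico (j + 1 + a) (M + 1 + a), B h = g * Γ := by
        rw [← Finset.sum_Ico_add', hΓ, Finset.mul_sum]
        refine Finset.sum_congr rfl fun k hk => ?_
        have hk1 : j + 1 ≤ k := (Finset.mem_Ico.1 hk).1
        have hn : k ∉ NW := by rw [memNW]; omega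
        simp only [hB]
        rw [if_neg (by omega : k + a ≠ 0), if_pos (Nat.le_add_left a k), Nat.add_sub_cancel, if_neg hn,
          if_neg (by omega : k + a ≠ a)]
        ring
      rw [← e]; exact hsub
    calc y / (1 - y) * ∑ l ∈ Finset.range (j + 1), (if 2 * (l : ℝ) < t then B l else 0)
        ≤ y / (1 - y) * (g * Esum) := mul_le_mul_of_nonneg_left hlow huy
      _ = g * (y / (1 - y) * Esum) := by ring
      _ ≤ g * Γ := mul_le_mul_of_nonneg_left hE hg0.le
      _ ≤ ∑ h ∈ Finset.Ico (j + 1) (M + a + 1), B h := hgiant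
  -- assemble
  have hflow : FlowAtT y t j (M + a) (fun h => (A h + C h) + B h) := FlowAtT.add (FlowAtT.add hAflow hCflow) hBflow
  obtain ⟨_, qM, q1, _⟩ := moved_laws ν a M g z ha hg0.le hg1 hz0 hzν hν0 hνM hν1
  rw [hP]
  refine decAtT_of_flowAtT y t j (M + a) _ hy0 hy1 (fun h hh => ?_) ?_ hflow
  · have := congrFun hP h
    rw [← this]; exact qM h hh
  · have e : ∀ h ∈ Finset.range (M + a + 1), (A h + C h) + B h
        = slice ν a g h + g * z * ((if h = 0 then (1 : ℝ) else 0) - (if h = a then (1 : ℝ) else 0)) :=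
      fun h _ => (congrFun hP h).symm
    rw [Finset.sum_congr rfl e]; exact q1

end LawDec

end Quant

end Summit.CriticalPhenomena.PercolationContinuityZ3.Theorems
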